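import Summits.AtomisticToContinuum.BoseEinsteinCondensation.Theses.BECSectorPoincareTwoScale
import Literature.MathematicalPhysics.QuantumManyBody.BoseGasThermodynamicLimitRuelle

/-!
# Route `BECSectorPoincareTwoScale`, support item `ScatteringLengthFinite` (stmt-AtomisticToContinuum-9006)

A repulsive finite-range pair potential `v : ℝ → ℝ≥0∞` (hard cores allowed) has finite scattering
length, `scatteringLength v ≠ ⊤`.

This is exactly the tree theorem
`Literature.MathematicalPhysics.QuantumManyBody.BoseGas.IsRepulsiveFiniteRange.scatteringLength_ne_top`
(LSSY 2005, App. C, Thm. C.1 and Remark 2): with `f` a smooth bump equal to `1` on a ball containing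
the range of `v(|·|)`, the `C¹` trial function `φ = 1 - f` makes the potential term
`½ v(|x|) |φ x|²` vanish identically (`∞ · 0 = 0` on a hard core), its kinetic term is finite
(continuous, compactly supported gradient), and `a ≤ (4π)⁻¹ 𝓔[φ] < ∞` by the variational
characterisation of the scattering length.

References: E. H. Lieb, R. Seiringer, J. P. Solovej, J. Yngvason, *The Mathematics of the Bose Gas
and its Condensation* (2005), Appendix C.
-/

namespace Summit.AtomisticToContinuum.BoseEinsteinCondensation.Theorems

open Literature.MathematicalPhysics.QuantumManyBody.BoseGas

/-- **`ScatteringLengthFinite` holds** (settles stmt-AtomisticToContinuum-9006, exact route decl of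
`BECSectorPoincareTwoScale`; the decl is shared verbatim by the sibling BEC routes): every repulsive
finite-range potential `v` has `scatteringLength v ≠ ⊤`. Immediate from the Literature theorem
`IsRepulsiveFiniteRange.scatteringLength_ne_top` (bump-function trial in the variational principle).
[cite: LSSY2005, App. C, Thm. C.1, Remark 2] -/
theorem scatteringLengthFinite_proof :
    Summit.AtomisticToContinuum.BoseEinsteinCondensation.Theses.BECSectorPoincareTwoScale.ScatteringLengthFinite := by
  unfold Summit.AtomisticToContinuum.BoseEinsteinCondensation.Theses.BECSectorPoincareTwoScale.ScatteringLengthFinite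
  intro v hv
  exact hv.scatteringLength_ne_top

end Summit.AtomisticToContinuum.BoseEinsteinCondensation.Theorems
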